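import Summits.ValiantsHypothesis.ValiantsHypothesis.Theses.DivisionGap
import Summits.ValiantsHypothesis.ValiantsHypothesis.Theorems.DivisionGapZeroOneTransferSplit
import Summits.ValiantsHypothesis.ValiantsHypothesis.Theorems.DivisionGapZeroOneTransferTriangularDimersVP
import Literature.Computability.AlgebraicComplexity.IMMInVPProofs
import Summits.ValiantsHypothesis.ValiantsHypothesis.Theorems.DivisionGapZeroOneTransferStubZotOfUniform
import Summits.ValiantsHypothesis.ValiantsHypothesis.Theorems.DivisionGapZeroOneTransferStubUniformOfZot
import Summits.ValiantsHypothesis.ValiantsHypothesis.Theorems.DivisionGapZeroOneTransferStubResidualIMM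
import Summits.ValiantsHypothesis.ValiantsHypothesis.Theorems.DivisionGapZeroOneTransferStubZeroOneSpanCount
import Summits.ValiantsHypothesis.ValiantsHypothesis.Theorems.DivisionGapZeroOneTransferStubMmOfUniform
import Summits.ValiantsHypothesis.ValiantsHypothesis.Theorems.DivisionGapZeroOneTransferStubUniformOfMm
import Summits.ValiantsHypothesis.ValiantsHypothesis.Theorems.DivisionGapZeroOneTransferMmBlockFloor
import Summits.ValiantsHypothesis.ValiantsHypothesis.Theorems.DivisionGapZeroOneTransferTriPMPowLowerBound
import Summits.ValiantsHypothesis.ValiantsHypothesis.Theorems.DivisionGapZeroOneTransferMmEdgeFloor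
import Summits.ValiantsHypothesis.ValiantsHypothesis.Theorems.DivisionGapZeroOneTransferTriPMPowMulBlockFloor
import Summits.ValiantsHypothesis.ValiantsHypothesis.Theorems.DivisionGapZeroOneTransferMmMonomialInitialForm
import Summits.ValiantsHypothesis.ValiantsHypothesis.Theorems.DivisionGapZeroOneTransferFaceIsolationDefs
import Summits.ValiantsHypothesis.ValiantsHypothesis.Theorems.DivisionGapZeroOneTransferStubBlockComplementCover
import Summits.ValiantsHypothesis.ValiantsHypothesis.Theorems.DivisionGapZeroOneTransferFaceEngine
import Summits.ValiantsHypothesis.ValiantsHypothesis.Theorems.DivisionGapZeroOneTransferFaceIsolationForms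
import Summits.ValiantsHypothesis.ValiantsHypothesis.Theorems.DivisionGapZeroOneTransferBrickZoneUnique
import Summits.ValiantsHypothesis.ValiantsHypothesis.Theorems.DivisionGapZeroOneTransferBrickWallTiling
import Summits.ValiantsHypothesis.ValiantsHypothesis.Theorems.DivisionGapZeroOneTransferRingCover
import Summits.ValiantsHypothesis.ValiantsHypothesis.Theorems.DivisionGapZeroOneTransferOffHoriz
import Summits.ValiantsHypothesis.ValiantsHypothesis.Theorems.DivisionGapZeroOneTransferTorusD
import Summits.ValiantsHypothesis.ValiantsHypothesis.Theorems.DivisionGapZeroOneTransferSqPartner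
import Summits.ValiantsHypothesis.ValiantsHypothesis.Theorems.DivisionGapZeroOneTransferFewMonomials
import Summits.ValiantsHypothesis.ValiantsHypothesis.Theorems.DivisionGapZeroOneTransferPerIsolation
import Summits.ValiantsHypothesis.ValiantsHypothesis.Theorems.DivisionGapZeroOneTransferPerForms
import Summits.ValiantsHypothesis.ValiantsHypothesis.Theorems.DivisionGapZeroOneTransferPerFewMonomials
import Summits.ValiantsHypothesis.ValiantsHypothesis.Theorems.DivisionGapZeroOneTransferSqPowPartner

/-!
# Crux `DivisionGap.ZeroOneTransfer` (stmt-ValiantsHypothesis-5066) — line `charged-uncharged`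
(crux-strategist wall-breaker pass p1, 2026-08-17; line leads c8, c10; RESHAPED by line lead c11,
2026-08-17: Part A verbatim, Part B now tree theorems, Part C = four registered stubs, all landed;
line lead c12, 2026-08-17: Part D = five NEW registered stubs on the shape of MM certificates at `D_n`;
line lead c13, 2026-08-17: Part E = ISOLATING FACES — twelve NEW registered stubs E1–E8 (ALL LANDED p165023 p165327 p165831 p166725 p168736 p168952 p169065) and two compositions
`sq_partner_lower_bound` (the square-grid partner `Sq_n` is not an MM certificate for `D_n`) and
`fewMonomials_lower_bound` (MM certificates have more than `(n/m)²/2` monomials), see `section PartE` at the end)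

## Part A — the crux (unchanged): CHARGED/UNCHARGED DECOMPOSITION of H2

The crux asks, for every 0/1-coefficient family `f` whose complexification is in `VP_ℂ`, for a
nonzero cofactor `h ∈ ℝ≥0[x]` with `L₊(f_n · h) + L₊(h)` quasi-polynomial.  H2 is the exact
conjunction of the line's two registered crux-sized stubs (c8: `promote-stub`, both are the crux
in normal form; no worker is sent at them):

* `stub_monotoneMultiples` (MM, UNCHARGED TRANSFER);
* `stub_cofactorCharging` (CC, COFACTOR CHARGING).

GLUE IN TREE (lead c8, p137357): `Theorems/DivisionGapZeroOneTransferSplit.lean`,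
`zeroOneTransfer_of_split : MM → CC → ZeroOneTransfer`; the composition `zeroOneTransfer_of_stubs`
below is one line over it and concludes the crux BY NAME.

## Part B — the Kasteleyn debt `hVP` (lead c10): CLOSED IN THE TREE

All five Part-B stubs of c10 (B1 `stub_kasteleynDetSq` p142832, B2 `stub_pickParity` p143666,
B3 `stub_rhombusKasteleyn` p142479, B4 `stub_sqrtCheap` p142363, B5 `stub_dimerFamilyVP` p142460)
and their compositions (`Theorems/DivisionGapZeroOneTransferTriangularDimersVP.lean`, p144184:
`isVPFamily_triangularDimers`, `not_zeroOneTransfer_of_not_triangularDimersDivisionEasy`,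
`zeroOneTransfer_iff_triangularDimers_and_dimerLift`) are tree theorems; they are no longer
registered stubs of this skeleton and are only re-exported below (kill path: `¬ crux 4 → ¬ crux 3`
with no hypothesis left).

## Part C — NEW (lead c11): the two structural claims of STRATEGY-CENSUS the tree does not hold

* UNIFORMITY (`stub_zotOfUniform`, `stub_uniformOfZot`; composition `zeroOneTransfer_iff_uniform`):
  the crux is equivalent to a bound UNIFORM in the `VP` data — for every exponent `e` one constant
  `c` serving every `n`, every finite variable type of size `≤ n^e + e` and every 0/1 polynomial of
  degree and `ℂ`-complexity `≤ n^e + e` (STRATEGY-CENSUS §2e, recorded there as a signature only).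
  `⇐` is bookkeeping (one exponent dominating the three p-bounds of `IsVPFamily`); `⇒` is a
  finiteness/diagonal argument: at a fixed `n` only finitely many 0/1 polynomials of bounded degree
  in `Fin (n^e+e)` exist (so every level has SOME finite certificate bound and a violating level
  `n_c` must grow with `c`), the worst violator at each level assembles into ONE 0/1 `VP_ℂ` family,
  and the crux's constant for that family is contradicted at a level violating it; general variable
  types reduce to `Fin (n^e+e)` by injective renaming (`stub_divSubstClosure`, p107876, transports
  certificates back along the retraction).  Consequence for refuters: a counterexample to H2 may be
  assembled from FINITE witnesses `(n, f)` with uniformly bounded VP data; for provers: the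
  exponent may be fixed first.
* NISAN-WIDTH TRANSFER (`stub_residualIMM`, `stub_zeroOne_ncard_le_two_pow_finrank`; compositions
  `complexity_le_of_fewResiduals`, `complexity_le_of_nisanRank`): the ONE model in which
  "0/1 coefficients ⇒ positive computation" is a theorem (STRATEGY-CENSUS §1a(α), the solved
  sibling — weighted automata / ROABPs, Nisan 1991): in a fixed variable order `x₀, …, x_{N-1}`,
  let the PREFIX-RESIDUALS of `f` at cut `i` be the polynomials `Σ_{m : m|_{<i} = u} coeff_m(f)·x^{m|_{≥ i}}`
  (`u` ranging over prefix exponents; the rows of Nisan's `i`-th partial-coefficient matrix).  If at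
  every cut at most `W` distinct residuals occur then `f = tr` of an iterated product of
  `(W+1) × (W+1)` matrices whose entries are sub-sums of `1, x_i, …, x_i^d` (the deterministic
  "residual automaton"), so `L₊(f) ≤ (N+2)(W+1)³(d+2)²` by the tree's `complexity_immPoly_le` and
  `complexity_aeval_le` — NO subtraction, NO division; and for 0/1 coefficients `W ≤ 2^r`, `r` the
  real rank of the residual span (a set of 0/1 vectors spanning an `r`-dimensional space has at most
  `2^r` elements).  So H2 holds with `h = 1` and loss `2^{rank}` in the rank-characterised model —
  the calibration of why quasi-polynomial (not polynomial) loss is the natural scale of any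
  0/1 ⇒ positive transfer (its polylog-rank form is already the log-rank conjecture, census §1a(β)),
  and why it gives no lever on circuits (no coefficient matrix of a generic `VP` polynomial has
  small rank; `Literature.Barriers.ValiantsHypothesis.RankMethods`).

## Part D — NEW (lead c12): what an UNCHARGED certificate must look like at the decisive instance

`stub_monotoneMultiples` restricted to the decisive instance `D_n` (crux 4's rhombus dimers,
`triPM n` in the tree) reads: SOME nonzero `X ≥ 0` has `L₊(D_n · X)` quasi-polynomial.  Two
kernel-checked necessary conditions on any such `X` (negative rungs of MM, in the crux's encoding;
the lead's dossier of c11 asked for the first at degree `≤ n/64` and for `X = D_n` — both are settled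
here in much stronger form):

* (D-I) OMNIPRESENCE / ORDER FLOOR (`stub_blockRestriction`, `stub_blockComplementCover`; assembly
  `mm_certificate_blockFloor`): if ONE monomial of `X` misses (as first vertex) ONE aligned
  `m × m` sub-rhombus, then `L₊(D_m) - 1 ≤ L₊(D_n · X)` — substitute `1` outside the block, `0` on the
  edges leaving it (a positive projection: free), the product collapses to `N · D_m · X'` with
  `X'(0) ≠ 0`, and Valiant's bound for `D_m` survives unit-constant cofactors (`UnitH`).  Hence every
  monomial of a quasi-polynomial certificate meets EVERY aligned polylog-block: `ord X ≥ n²/polylog n`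
  (`= deg D_n / polylog`), uniformly — cofactors are as large as `D_n` itself and omnipresent at all
  polylog scales (the H2 mirror of the H1 side's open `stub_noCheapOmnipresence`, here a THEOREM of
  necessity).
* (D-II) POWERS ARE NOT CERTIFICATES (`stub_typedGadgets`, `stub_forbiddenPeel`,
  `stub_dimerTypedDecomposition`; assembly `triPM_pow_lower_bound`): `T^L ≤ L₊(D_n^M) · (T-1)^L` for
  every `M ≥ 1` (`T = 6^44`, `24L + 60 ≤ n`), i.e. `L₊(D_n^M) ≥ 2^{Ω(n)}` UNIFORMLY in `M` — in
  particular the double-dimer partition function `det(Kasteleyn) = D_n²`, the card's first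
  bosonisation candidate, is exponentially hard for monotone circuits, and no power `X = D_n^{M-1}`
  is an MM certificate.  Mechanism (the `D_n`-version of the typed vertex count for `per^M`,
  `DivisionGapPerDivisionHardPerPowers`): typed row-support-balanced decomposition
  (`stub_dimerTypedDecomposition`, port of `stub_typedDecomposition` of crux 9 to vertex-indexed
  variables); a pure monomial `M·μ_f` served by a typed product forces `f` to respect the type
  partition `(Z, W)` (`x ∈ Z ↔ f x ∈ W`); such covers avoid every FORBIDDEN edge (pattern of `v` ≠
  swap of pattern of `u`); far-apart valid gadgets with a forbidden centre edge OR a forbidden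
  diagonal `19–25` exist in number `≥ (n-60)/24` for every balanced `Z` (`stub_typedGadgets`: either a
  swap-closed union of classes is balanced — Valiant's cut gadgets — or the symmetric difference
  `Z △ W` covers `> 2/3` of the rhombus and then all but `< n²/3` unit triangles carry a forbidden
  edge); peeling works for both kinds because the gadget's two local covers use `{18–25, 12–19}` resp.
  `{18–12, 19–25}` (`stub_forbiddenPeel`).

ALL FOUR PART-C STUBS ARE LANDED (lead c11, wave 1, 2026-08-17): C1 `stub_zotOfUniform` p147049,
C2 `stub_uniformOfZot` p148580, C3 `stub_residualIMM` p149981, C4 `stub_zeroOne_ncard_le_two_pow_finrank`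
p150838; the compositions below are sorry-free (and LANDED: `zeroOneTransfer_iff_uniform` p151546,
`complexity_le_of_fewResiduals` / `complexity_le_of_nisanRank` p151600).  Part C′ (wave 2,
LANDED as the `:=`-free twins `mmOfUniform` p152190, `uniformOfMm` p152548): `stub_mmOfUniform`,
`stub_uniformOfMm` (uniformity of the child MM).  `sorry` only inside the two Part-A stubs
`stub_monotoneMultiples`, `stub_cofactorCharging` (the crux).  ALL FIVE PART-D STUBS ARE LANDED (lead c12,
wave 1, 2026-08-17): D1 `stub_blockRestriction` p156315, D2 `stub_blockComplementCover` p156500, D5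
`stub_typedGadgets` p157140, D6 `stub_forbiddenPeel` p157703, D7 `stub_dimerTypedDecomposition` p157939, and so
are the two Part-D assemblies (`Theorems/DivisionGapZeroOneTransferMmBlockFloor.lean` p158446,
`Theorems/DivisionGapZeroOneTransferTriPMPowLowerBound.lean` p158570), plus D-I′ (`…MmEdgeFloor.lean` p159118: edge-variable
floor) D-III (`…TriPMPowMulBlockFloor.lean` p159397: `D_n^M · Y` with `Y` sparse somewhere) and D-IV
(`…MmMonomialInitialForm.lean` p160331: no monomial initial/final form in a `D_n`-degenerate direction), re-exported below.

Further registered stubs of the line, ALL LANDED (lead c8): `cofactorCharging_monomialTop` p137731,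
`cofactorCharging_largeCostRegime` p138306, `cofactorCharging_of_monotoneKaltofen` p137722,
`perMultiplesHard_of_monotoneKaltofen` p138224, `monotoneMultiples_false_without_VP` p138184,
`valiantsHypothesis_of_perMultiplesHard_of_monotoneMultiples` p138447.
-/

open MvPolynomial
open Literature.Computability.AlgebraicComplexity
open Summit.ValiantsHypothesis.ValiantsHypothesis.Theses.DivisionGap
open scoped NNReal BigOperators

-- `Summit.ValiantsHypothesis.ValiantsHypothesis.…`: mandated layout (Sub = Summit), intended.
set_option linter.dupNamespace false

namespace Summit.ValiantsHypothesis.ValiantsHypothesis.Cruxes.ZeroOneTransfer.ChargedUncharged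

/-! ### Part A — the two registered crux stubs (verbatim from c8) -/

/-- **Stub 1 — UNCHARGED TRANSFER (`MonotoneMultiples`).**  Every 0/1-coefficient `VP_ℂ` family has,
for some `c` and all `n`, a nonzero nonnegative multiple `f_n · h` with `L₊(f_n · h) ≤ 2^((log₂ n + c)^c)`;
the cofactor `h` is NOT charged.  Equivalently: `f_n` is a nonnegative FACTOR of a division-easy
polynomial.  Decisive instance: Valiant's rhombus dimers `D_n` (crux 4), where any
{+,×,÷}-computation of ANY product `D_n · X` (`X ≥ 0`) proves it. -/
theorem stub_monotoneMultiples :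
    ∀ (σ : ℕ → Type) [∀ n, Fintype (σ n)] (f : ∀ n, MvPolynomial (σ n) NNReal), (∀ n m, MvPolynomial.coeff m (f n) = 0 ∨ MvPolynomial.coeff m (f n) = 1) → Literature.Computability.AlgebraicComplexity.IsVPFamily (k := ℂ) (fun n => MvPolynomial.map (Complex.ofRealHom.comp NNReal.toRealHom) (f n)) → ∃ c : ℕ, ∀ n, ∃ h : MvPolynomial (σ n) NNReal, h ≠ 0 ∧ Literature.Computability.AlgebraicComplexity.complexity (f n * h) ≤ 2 ^ ((Nat.log 2 n + c) ^ c) := by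
  sorry

/-- **Stub 2 — COFACTOR CHARGING (`CofactorCharging`).**  For every 0/1-coefficient `VP_ℂ` family
there is `k` such that every nonzero cofactor `h` can be replaced by a nonzero `h'` with
`L₊(f_n h') + L₊(h') ≤ 2^((log₂ n + log₂ L₊(f_n h) + k)^k)`.  The fermion-free residue of H2; its clean
form for all nonnegative `f` ("monotone Kaltofen", registered reduction
`cofactorCharging_of_monotoneKaltofen`) also gives `PerDivisionHard → PerMultiplesHard`. -/
theorem stub_cofactorCharging :
    ∀ (σ : ℕ → Type) [∀ n, Fintype (σ n)] (f : ∀ n, MvPolynomial (σ n) NNReal), (∀ n m, MvPolynomial.coeff m (f n) = 0 ∨ MvPolynomial.coeff m (f n) = 1) → Literature.Computability.AlgebraicComplexity.IsVPFamily (k := ℂ) (fun n => MvPolynomial.map (Complex.ofRealHom.comp NNReal.toRealHom) (f n)) → ∃ k : ℕ, ∀ n, ∀ h : MvPolynomial (σ n) NNReal, h ≠ 0 → ∃ h' : MvPolynomial (σ n) NNReal, h' ≠ 0 ∧ Literature.Computability.AlgebraicComplexity.complexity (f n * h') + Literature.Computability.AlgebraicComplexity.complexity h' ≤ 2 ^ ((Nat.log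 2 n + Nat.log 2 (Literature.Computability.AlgebraicComplexity.complexity (f n * h)) + k) ^ k) := by
  sorry

/-! ### Part A — the composition: the crux from the two stubs (glue = tree theorem p137357) -/

/-- The crux from the two registered stubs, by the tree's glue
`DivisionGapZeroOneTransfer.zeroOneTransfer_of_split` (modus ponens + quasi-polynomial
absorption).  Concludes `ZeroOneTransfer` BY NAME; closed modulo the two stubs. -/
theorem zeroOneTransfer_of_stubs : ZeroOneTransfer :=
  Summit.ValiantsHypothesis.ValiantsHypothesis.Theorems.DivisionGapZeroOneTransfer.zeroOneTransfer_of_split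
    stub_monotoneMultiples stub_cofactorCharging

/-! ### Part B — the Kasteleyn debt, now tree theorems (re-exported) -/

/-- **`D_n ∈ VP_ℂ`** (Valiant 1980 Thm 2 for the rhombus; Kasteleyn) — tree theorem p144184
(`isVPFamily_triangularDimers`), formerly the composition of the five Part-B stubs of c10.
[cite: Valiant1980, §3 Thm. 2] -/
theorem isVPFamily_triangularDimers_tree :
    IsVPFamily (k := ℂ) fun n => MvPolynomial.map (Complex.ofRealHom.comp NNReal.toRealHom)
      (∑ f ∈ (Finset.univ : Finset (Fin n × Fin n → Fin n × Fin n)).filter (fun f => ∀ v, f (f v) = v ∧ f v ≠ v ∧ (((v.1 : ℕ) + 1 = (f v).1 ∧ (v.2 : ℕ) = (f v).2) ∨ (((f v).1 : ℕ) + 1 = v.1 ∧ (v.2 : ℕ) = (f v).2) ∨ ((v.1 : ℕ) = (f v).1 ∧ (v.2 : ℕ) + 1 = (f v).2) ∨ ((v.1 : ℕ) = (f v).1 ∧ ((f v).2 : ℕ) + 1 = v.2) ∨ ((v.1 : ℕ) + 1 = (f v).1 ∧ ((f v).2 : ℕ) + 1 = v.2) ∨ (((f v).1 : ℕ) + 1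 = v.1 ∧ (v.2 : ℕ) + 1 = (f v).2))), ∏ v : Fin n × Fin n, (MvPolynomial.X (v, f v) : MvPolynomial ((Fin n × Fin n) × (Fin n × Fin n)) NNReal)) :=
  Summit.ValiantsHypothesis.ValiantsHypothesis.Theorems.DivisionGapZeroOneTransfer.isVPFamily_triangularDimers

/-- **The kill criterion, unconditional** (tree theorem p144184): if crux 4
(`TriangularDimersDivisionEasy`) fails then so does the crux `ZeroOneTransfer`.
[cite: FominGrigorievKoshevoy2014, Remark 1.5] -/
theorem not_zeroOneTransfer_of_triangularDimers_hard_tree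
    (hhard : ¬ TriangularDimersDivisionEasy) : ¬ ZeroOneTransfer :=
  Summit.ValiantsHypothesis.ValiantsHypothesis.Theorems.DivisionGapZeroOneTransfer.not_zeroOneTransfer_of_not_triangularDimersDivisionEasy
    hhard

/-! ### Part C — UNIFORMITY: `ZeroOneTransfer ⟺ ZeroOneTransferUniform` (two registered stubs) -/

/-- **Stub C1 — the uniform form implies the crux** (bookkeeping).  The uniform form: for every
exponent `e` ONE constant `c` such that every 0/1 polynomial `f` over `ℝ≥0` in a finite variable
type of size `≤ n^e + e`, of total degree `≤ n^e + e` and of `ℂ`-complexity `≤ n^e + e`, has a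
nonzero `h` with `L₊(f·h) + L₊(h) ≤ 2^((log₂ n + c)^c)`.  Given a 0/1 `VP_ℂ` family, one exponent
`e` dominates the three p-bounds of `IsVPFamily` (`n^a + a ≤ n^e + e` for `a ≤ e`, also at
`n = 0`), and the uniform constant for `e` serves every level `n`. [folklore] -/
theorem stub_zotOfUniform :
    (∀ e : ℕ, ∃ c : ℕ, ∀ (n : ℕ) (τ : Type) [Fintype τ] (f : MvPolynomial τ NNReal),
      (∀ m, MvPolynomial.coeff m f = 0 ∨ MvPolynomial.coeff m f = 1) →
      Fintype.card τ ≤ n ^ e + e → f.totalDegree ≤ n ^ e + e →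
      Literature.Computability.AlgebraicComplexity.complexity
        (MvPolynomial.map (Complex.ofRealHom.comp NNReal.toRealHom) f) ≤ n ^ e + e →
      ∃ h : MvPolynomial τ NNReal, h ≠ 0 ∧
        Literature.Computability.AlgebraicComplexity.complexity (f * h) +
          Literature.Computability.AlgebraicComplexity.complexity h ≤ 2 ^ ((Nat.log 2 n + c) ^ c)) →
    ZeroOneTransfer :=
  -- LANDED (wave 1, p147049): Theorems/DivisionGapZeroOneTransferStubZotOfUniform.lean
  Summit.ValiantsHypothesis.ValiantsHypothesis.Theorems.DivisionGapZeroOneTransfer.stub_zotOfUniform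

/-- **Stub C2 — the crux implies its uniform form** (finiteness + diagonal).  Fix `e` and suppose no
`c` works.  (i) REDUCTION TO `Fin (n^e+e)`: rename a violator injectively into `Fin (n^e + e)`; 0/1
coefficients, the degree bound (`totalDegree_rename_le`) and the `ℂ`-complexity bound
(`complexity_rename_le` after `map_rename`) persist, and so does the violation, because a certificate
`rename ι f · h' = g'` pulls back along the retraction `Fin (n^e+e) → τ ∪ {1}` at no cost
(`DivisionGapZeroOneTransfer.stub_divSubstClosure`, all substituends `X _` or `1`).  (ii) FINITENESS:
at a fixed level `n` there are finitely many 0/1 polynomials in `Fin (n^e+e)` of total degree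
`≤ n^e + e` (determined by their support, a subset of the finite set of exponents of degree `≤ n^e+e`),
each with the finite certificate `h = 1` (`stub_sparsePolyComplexity`), so the set of `c` violated at
level `n` is bounded (`2^((log₂ n + c)^c) ≥ c`), while by assumption every `c` is violated at some
level: the violating levels are unbounded.  (iii) DIAGONAL: let `f n` be a violator at level `n` of
the LARGEST violated `c` there (and `0` at levels violating nothing); `n ↦ f n` is a 0/1 family in
`Fin (n^e+e)` variables with degree and `ℂ`-complexity `≤ n^e + e`, hence `IsVPFamily` over `ℂ`;
the crux gives `c₀` for it, and a level `n` violating some `c ≥ c₀` (monotonicity of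
`2^((log₂ n + c)^c)` in `c`) contradicts it. [folklore] -/
theorem stub_uniformOfZot :
    ZeroOneTransfer →
    ∀ e : ℕ, ∃ c : ℕ, ∀ (n : ℕ) (τ : Type) [Fintype τ] (f : MvPolynomial τ NNReal),
      (∀ m, MvPolynomial.coeff m f = 0 ∨ MvPolynomial.coeff m f = 1) →
      Fintype.card τ ≤ n ^ e + e → f.totalDegree ≤ n ^ e + e →
      Literature.Computability.AlgebraicComplexity.complexity
        (MvPolynomial.map (Complex.ofRealHom.comp NNReal.toRealHom) f) ≤ n ^ e + e →
      ∃ h : MvPolynomial τ NNReal, h ≠ 0 ∧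
        Literature.Computability.AlgebraicComplexity.complexity (f * h) +
          Literature.Computability.AlgebraicComplexity.complexity h ≤ 2 ^ ((Nat.log 2 n + c) ^ c) :=
  -- LANDED (wave 1, p148580): Theorems/DivisionGapZeroOneTransferStubUniformOfZot.lean
  Summit.ValiantsHypothesis.ValiantsHypothesis.Theorems.DivisionGapZeroOneTransfer.stub_uniformOfZot

/-- **UNIFORMITY of the crux** (composition of Stubs C1, C2): `ZeroOneTransfer` is equivalent to its
uniform form — for every exponent `e` one constant `c` serving all 0/1 polynomials whose number of
variables, degree and `ℂ`-complexity are `≤ n^e + e`.  The `∃ c` placed after the family in the crux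
gives no protection (STRATEGY-CENSUS §2e). [folklore] -/
theorem zeroOneTransfer_iff_uniform :
    ZeroOneTransfer ↔
    ∀ e : ℕ, ∃ c : ℕ, ∀ (n : ℕ) (τ : Type) [Fintype τ] (f : MvPolynomial τ NNReal),
      (∀ m, MvPolynomial.coeff m f = 0 ∨ MvPolynomial.coeff m f = 1) →
      Fintype.card τ ≤ n ^ e + e → f.totalDegree ≤ n ^ e + e →
      Literature.Computability.AlgebraicComplexity.complexity
        (MvPolynomial.map (Complex.ofRealHom.comp NNReal.toRealHom) f) ≤ n ^ e + e →
      ∃ h : MvPolynomial τ NNReal, h ≠ 0 ∧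
        Literature.Computability.AlgebraicComplexity.complexity (f * h) +
          Literature.Computability.AlgebraicComplexity.complexity h ≤ 2 ^ ((Nat.log 2 n + c) ^ c) :=
  ⟨stub_uniformOfZot, stub_zotOfUniform⟩

/-! ### Part C′ — UNIFORMITY OF THE UNCHARGED CHILD `MonotoneMultiples` (two registered stubs)

The planner's intended route split files MM (Stub 1) as a child item; its quantifier shape is the
crux's, so the same finiteness/diagonal argument makes MM equivalent to a bound uniform in the `VP`
data (the certificate `h = 1` again bounds every level; `L₊(h)` is simply not charged). -/

/-- **Stub C5 — the uniform form of MM implies MM** (bookkeeping, as Stub C1 without the `L₊(h)`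
term). [folklore] -/
theorem stub_mmOfUniform :
    (∀ e : ℕ, ∃ c : ℕ, ∀ (n : ℕ) (τ : Type) [Fintype τ] (f : MvPolynomial τ NNReal),
      (∀ m, MvPolynomial.coeff m f = 0 ∨ MvPolynomial.coeff m f = 1) →
      Fintype.card τ ≤ n ^ e + e → f.totalDegree ≤ n ^ e + e →
      Literature.Computability.AlgebraicComplexity.complexity
        (MvPolynomial.map (Complex.ofRealHom.comp NNReal.toRealHom) f) ≤ n ^ e + e →
      ∃ h : MvPolynomial τ NNReal, h ≠ 0 ∧
        Literature.Computability.AlgebraicComplexity.complexity (f * h) ≤ 2 ^ ((Nat.log 2 n + c) ^ c)) →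
    (∀ (σ : ℕ → Type) [∀ n, Fintype (σ n)] (f : ∀ n, MvPolynomial (σ n) NNReal), (∀ n m, MvPolynomial.coeff m (f n) = 0 ∨ MvPolynomial.coeff m (f n) = 1) → Literature.Computability.AlgebraicComplexity.IsVPFamily (k := ℂ) (fun n => MvPolynomial.map (Complex.ofRealHom.comp NNReal.toRealHom) (f n)) → ∃ c : ℕ, ∀ n, ∃ h : MvPolynomial (σ n) NNReal, h ≠ 0 ∧ Literature.Computability.AlgebraicComplexity.complexity (f n * h) ≤ 2 ^ ((Nat.log 2 n + c) ^ c)) :=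
  -- LANDED (wave 2, p152190): Theorems/DivisionGapZeroOneTransferStubMmOfUniform.lean (`:=`-free twin `mmOfUniform`)
  Summit.ValiantsHypothesis.ValiantsHypothesis.Theorems.DivisionGapZeroOneTransfer.mmOfUniform

/-- **Stub C6 — MM implies its uniform form** (finiteness + diagonal, as Stub C2 without the
`L₊(h)` term: transport to `Fin (n^e+e)` by injective renaming and `stub_divSubstClosure`, the
certificate `h = 1` via `stub_sparsePolyComplexity` bounds the violated constants at each level,
the worst violator per level assembles into one 0/1 `VP_ℂ` family). [folklore] -/
theorem stub_uniformOfMm :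
    (∀ (σ : ℕ → Type) [∀ n, Fintype (σ n)] (f : ∀ n, MvPolynomial (σ n) NNReal), (∀ n m, MvPolynomial.coeff m (f n) = 0 ∨ MvPolynomial.coeff m (f n) = 1) → Literature.Computability.AlgebraicComplexity.IsVPFamily (k := ℂ) (fun n => MvPolynomial.map (Complex.ofRealHom.comp NNReal.toRealHom) (f n)) → ∃ c : ℕ, ∀ n, ∃ h : MvPolynomial (σ n) NNReal, h ≠ 0 ∧ Literature.Computability.AlgebraicComplexity.complexity (f n * h) ≤ 2 ^ ((Nat.log 2 n + c) ^ c)) →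
    (∀ e : ℕ, ∃ c : ℕ, ∀ (n : ℕ) (τ : Type) [Fintype τ] (f : MvPolynomial τ NNReal),
      (∀ m, MvPolynomial.coeff m f = 0 ∨ MvPolynomial.coeff m f = 1) →
      Fintype.card τ ≤ n ^ e + e → f.totalDegree ≤ n ^ e + e →
      Literature.Computability.AlgebraicComplexity.complexity
        (MvPolynomial.map (Complex.ofRealHom.comp NNReal.toRealHom) f) ≤ n ^ e + e →
      ∃ h : MvPolynomial τ NNReal, h ≠ 0 ∧
        Literature.Computability.AlgebraicComplexity.complexity (f * h) ≤ 2 ^ ((Nat.log 2 n + c) ^ c)) :=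
  -- LANDED (wave 2, p152548): Theorems/DivisionGapZeroOneTransferStubUniformOfMm.lean (`:=`-free twin `uniformOfMm`)
  Summit.ValiantsHypothesis.ValiantsHypothesis.Theorems.DivisionGapZeroOneTransfer.uniformOfMm

/-- **UNIFORMITY of `MonotoneMultiples`** (composition of Stubs C5, C6): the uncharged child of the
crux is equivalent to its uniform form. [folklore] -/
theorem monotoneMultiples_iff_uniform :
    (∀ (σ : ℕ → Type) [∀ n, Fintype (σ n)] (f : ∀ n, MvPolynomial (σ n) NNReal), (∀ n m, MvPolynomial.coeff m (f n) = 0 ∨ MvPolynomial.coeff m (f n) = 1) → Literature.Computability.AlgebraicComplexity.IsVPFamily (k := ℂ) (fun n => MvPolynomial.map (Complex.ofRealHom.comp NNReal.toRealHom) (f n)) → ∃ c : ℕ, ∀ n, ∃ h : MvPolynomial (σ n) NNReal, h ≠ 0 ∧ Literature.Computability.AlgebraicComplexity.complexity (f n * h) ≤ 2 ^ ((Nat.log 2 n + c) ^ c)) ↔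
    (∀ e : ℕ, ∃ c : ℕ, ∀ (n : ℕ) (τ : Type) [Fintype τ] (f : MvPolynomial τ NNReal),
      (∀ m, MvPolynomial.coeff m f = 0 ∨ MvPolynomial.coeff m f = 1) →
      Fintype.card τ ≤ n ^ e + e → f.totalDegree ≤ n ^ e + e →
      Literature.Computability.AlgebraicComplexity.complexity
        (MvPolynomial.map (Complex.ofRealHom.comp NNReal.toRealHom) f) ≤ n ^ e + e →
      ∃ h : MvPolynomial τ NNReal, h ≠ 0 ∧
        Literature.Computability.AlgebraicComplexity.complexity (f * h) ≤ 2 ^ ((Nat.log 2 n + c) ^ c)) :=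
  ⟨stub_uniformOfMm, stub_mmOfUniform⟩

/-! ### Part C — NISAN-WIDTH TRANSFER (two registered stubs)

Prefix-residuals.  For `f : MvPolynomial (Fin N) ℝ≥0`, a cut `i : ℕ` and a prefix exponent
`u : Fin N →₀ ℕ`, the residual of `f` at `(i, u)` is
`Σ_{m ∈ supp f, m|_{<i} = u} coeff_m(f) · X^{m|_{≥ i}}` — written inline with `Finsupp.filter`.
The set of residuals at cut `i` (over all `u`; it always contains `0`) is finite; its size is the
width of the deterministic residual automaton of `f` (for 0/1 coefficients: the number of distinct
rows of Nisan's `i`-th partial-coefficient matrix, plus the zero row). -/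

/-- **Stub C3 — THE RESIDUAL AUTOMATON IS AN ITERATED MATRIX PRODUCT.**  If at every cut `i ≤ N`
the polynomial `f ∈ ℝ≥0[x₀,…,x_{N-1}]` (individual degrees `≤ d`) has at most `W` distinct
prefix-residuals, then `f` is obtained from the tree's iterated-matrix-multiplication polynomial
`immPoly (W+1) (N+2) ℝ≥0 = tr(X⁽⁰⁾ ⋯ X⁽ᴺ⁺¹⁾)` by substituting, for every variable `X⁽ᵗ⁾_{ab}`, a
polynomial of monotone complexity `≤ (d+1)²` — namely: layer `0` a constant matrix unit selecting
the class of `f` (the residual at `(0,0)`), layer `t = i+1` (`i < N`) the TRANSITION MATRIX whose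
`(a,b)` entry is `Σ {x_i^j : j ≤ d, residual_{i+1}(u_a + j·e_i) = b-th class}` for a chosen
representative `u_a` of the `a`-th residual class at cut `i` (unused indices: zero rows/columns),
layer `N+1` the constant column of the classes at cut `N` (constants `coeff_u f`) — because
`residual_i(u) = Σ_{j ≤ d} x_i^j · residual_{i+1}(u + j·e_i)` for prefix-supported `u`, so the class
vector at cut `i` is the transition matrix applied to the class vector at cut `i+1`, and
`f = residual_0(0)`.  Entry cost: `Σ_{j ∈ J} x^j`, `J ⊆ {0,…,d}`, costs `≤ (d+1)²` gates
(`SparsePoly.complexity_X_pow_le`, one addition per term). [cite: Nisan1991, Thm. 1 (the ABP-width characterisation; here its monotone/deterministic form)] -/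
theorem stub_residualIMM :
    ∀ (N d W : ℕ) (f : MvPolynomial (Fin N) NNReal),
      (∀ m ∈ f.support, ∀ j : Fin N, m j ≤ d) →
      (∀ i : ℕ, i ≤ N →
        {g : MvPolynomial (Fin N) NNReal | ∃ u : Fin N →₀ ℕ,
            g = ∑ m ∈ f.support with Finsupp.filter (fun j : Fin N => (j : ℕ) < i) m = u,
                  MvPolynomial.monomial (Finsupp.filter (fun j : Fin N => i ≤ (j : ℕ)) m)
                    (MvPolynomial.coeff m f)}.ncard ≤ W) →
      ∃ g : Fin (N + 2) × Fin (W + 1) × Fin (W + 1) → MvPolynomial (Fin N) NNReal,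
        f = MvPolynomial.aeval g (immPoly (W + 1) (N + 2) NNReal) ∧
        ∀ t, Literature.Computability.AlgebraicComplexity.complexity (g t) ≤ (d + 1) ^ 2 :=
  -- LANDED (wave 1, p149981): Theorems/DivisionGapZeroOneTransferStubResidualIMM.lean
  Summit.ValiantsHypothesis.ValiantsHypothesis.Theorems.DivisionGapZeroOneTransfer.stub_residualIMM

/-- **Stub C4 — FEW 0/1 VECTORS IN A LOW-DIMENSIONAL SPAN.**  A finite set `S` of real polynomials
all of whose coefficients are `0` or `1` has at most `2^r` elements, `r` the dimension of its real
span: the coefficient functionals restricted to `V = span S` span the dual of `V`, so `r` of them are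
jointly injective on `V` (equivalently: a column basis `J`, `|J| = r`, of the coefficient matrix of
`S` determines every row), and `S` injects into `{0,1}^J`. [folklore] -/
theorem stub_zeroOne_ncard_le_two_pow_finrank :
    ∀ (σ : Type) (S : Set (MvPolynomial σ ℝ)), S.Finite →
      (∀ g ∈ S, ∀ m, MvPolynomial.coeff m g = 0 ∨ MvPolynomial.coeff m g = 1) →
      S.ncard ≤ 2 ^ Module.finrank ℝ (Submodule.span ℝ S) :=
  -- LANDED (wave 1, p150838): Theorems/DivisionGapZeroOneTransferStubZeroOneSpanCount.lean
  Summit.ValiantsHypothesis.ValiantsHypothesis.Theorems.DivisionGapZeroOneTransfer.stub_zeroOne_ncard_le_two_pow_finrank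

/-! ### Part C — compositions of the Nisan-width transfer -/

/-- **Monotone complexity is polynomial in the residual width** (from Stub C3 and the tree's
`complexity_aeval_le`, `complexity_immPoly_le`): at most `W` distinct prefix-residuals at every cut
and individual degrees `≤ d` give `L₊(f) ≤ (N+2)(W+1)³(d+2)²` — no subtraction, no division.
[cite: Nisan1991, Thm. 1] -/
theorem complexity_le_of_fewResiduals (N d W : ℕ) (f : MvPolynomial (Fin N) NNReal)
    (hd : ∀ m ∈ f.support, ∀ j : Fin N, m j ≤ d)
    (hW : ∀ i : ℕ, i ≤ N →
      {g : MvPolynomial (Fin N) NNReal | ∃ u : Fin N →₀ ℕ,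
          g = ∑ m ∈ f.support with Finsupp.filter (fun j : Fin N => (j : ℕ) < i) m = u,
                MvPolynomial.monomial (Finsupp.filter (fun j : Fin N => i ≤ (j : ℕ)) m)
                  (MvPolynomial.coeff m f)}.ncard ≤ W) :
    Literature.Computability.AlgebraicComplexity.complexity f ≤ (N + 2) * (W + 1) ^ 3 * (d + 2) ^ 2 := by
  obtain ⟨g, hfg, hg⟩ := stub_residualIMM N d W f hd hW
  have h1 : Literature.Computability.AlgebraicComplexity.complexity f ≤
      ((W + 1) + 2 * (W + 1) ^ 3 * (N + 2)) +
        ∑ _t : Fin (N + 2) × Fin (W + 1) × Fin (W + 1), (d + 1) ^ 2 := by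
    rw [hfg]
    calc Literature.Computability.AlgebraicComplexity.complexity
          (MvPolynomial.aeval g (immPoly (W + 1) (N + 2) NNReal))
        ≤ Literature.Computability.AlgebraicComplexity.complexity (immPoly (W + 1) (N + 2) NNReal) +
            ∑ t, Literature.Computability.AlgebraicComplexity.complexity (g t) :=
          complexity_aeval_le _ _
      _ ≤ ((W + 1) + 2 * (W + 1) ^ 3 * (N + 2)) +
            ∑ _t : Fin (N + 2) × Fin (W + 1) × Fin (W + 1), (d + 1) ^ 2 :=
          Nat.add_le_add (complexity_immPoly_le NNReal (W + 1) (N + 2))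
            (Finset.sum_le_sum fun t _ => hg t)
  refine h1.trans ?_
  rw [Finset.sum_const, Finset.card_univ, smul_eq_mul, Fintype.card_prod, Fintype.card_prod,
    Fintype.card_fin, Fintype.card_fin]
  have hW1 : 1 ≤ W + 1 := Nat.succ_pos W
  have hsq : (W + 1) * (W + 1) ≤ (W + 1) ^ 3 := by
    calc (W + 1) * (W + 1) = (W + 1) ^ 2 * 1 := by ring
      _ ≤ (W + 1) ^ 2 * (W + 1) := Nat.mul_le_mul_left _ hW1
      _ = (W + 1) ^ 3 := by ring
  have hlin : W + 1 ≤ (W + 1) ^ 3 * (N + 2) := by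
    calc W + 1 = (W + 1) * 1 * 1 := by ring
      _ ≤ (W + 1) * ((W + 1) * (W + 1)) * (N + 2) :=
          Nat.mul_le_mul (Nat.mul_le_mul_left _ (Nat.mul_le_mul hW1 hW1)) (by omega)
      _ = (W + 1) ^ 3 * (N + 2) := by ring
  calc (W + 1) + 2 * (W + 1) ^ 3 * (N + 2) + (N + 2) * ((W + 1) * (W + 1)) * (d + 1) ^ 2
      ≤ (W + 1) ^ 3 * (N + 2) + 2 * (W + 1) ^ 3 * (N + 2) + (N + 2) * (W + 1) ^ 3 * (d + 1) ^ 2 := by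
        gcongr
    _ = (N + 2) * (W + 1) ^ 3 * (3 + (d + 1) ^ 2) := by ring
    _ ≤ (N + 2) * (W + 1) ^ 3 * (d + 2) ^ 2 := Nat.mul_le_mul_left _ (by
        calc 3 + (d + 1) ^ 2 = d * d + 2 * d + 4 := by ring
          _ ≤ d * d + 4 * d + 4 := by omega
          _ = (d + 2) ^ 2 := by ring)

/-- Coefficients of a prefix-residual are coefficients of `f` or `0`: the monomials `m` of `f` with
prefix `u` and suffix `m'` number at most one (`m = u + m'`). [folklore] -/
theorem coeff_residual_zero_or_one {N : ℕ} (f : MvPolynomial (Fin N) NNReal)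
    (hf : ∀ m, MvPolynomial.coeff m f = 0 ∨ MvPolynomial.coeff m f = 1) (i : ℕ)
    (u m' : Fin N →₀ ℕ) :
    MvPolynomial.coeff m'
        (∑ m ∈ f.support with Finsupp.filter (fun j : Fin N => (j : ℕ) < i) m = u,
          MvPolynomial.monomial (Finsupp.filter (fun j : Fin N => i ≤ (j : ℕ)) m)
            (MvPolynomial.coeff m f)) = 0 ∨
      MvPolynomial.coeff m'
        (∑ m ∈ f.support with Finsupp.filter (fun j : Fin N => (j : ℕ) < i) m = u,
          MvPolynomial.monomial (Finsupp.filter (fun j : Fin N => i ≤ (j : ℕ)) m)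
            (MvPolynomial.coeff m f)) = 1 := by
  classical
  rw [MvPolynomial.coeff_sum]
  simp only [MvPolynomial.coeff_monomial]
  -- every summand vanishes unless `m = u + m'`
  have key : ∀ m ∈ f.support.filter (fun m => Finsupp.filter (fun j : Fin N => (j : ℕ) < i) m = u),
      (if Finsupp.filter (fun j : Fin N => i ≤ (j : ℕ)) m = m' then MvPolynomial.coeff m f else 0) =
        if m = u + m' then MvPolynomial.coeff (u + m') f *
          (if Finsupp.filter (fun j : Fin N => (j : ℕ) < i) (u + m') = u ∧
              Finsupp.filter (fun j : Fin N => i ≤ (j : ℕ)) (u + m') = m' then 1 else 0) else 0 := by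
    intro m hm
    rw [Finset.mem_filter] at hm
    obtain ⟨-, hpre⟩ := hm
    by_cases hsuf : Finsupp.filter (fun j : Fin N => i ≤ (j : ℕ)) m = m'
    · have hm : m = u + m' := by
        rw [← hpre, ← hsuf]
        ext j
        simp only [Finsupp.add_apply, Finsupp.filter_apply]
        by_cases hj : (j : ℕ) < i
        · rw [if_pos hj, if_neg (not_le.2 hj), add_zero]
        · rw [if_neg hj, if_pos (not_lt.1 hj), zero_add]
      subst hm
      rw [if_pos hsuf, if_pos rfl, if_pos ⟨hpre, hsuf⟩, mul_one]
    · rw [if_neg hsuf]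
      by_cases hm : m = u + m'
      · subst hm
        rw [if_pos rfl, if_neg (fun h => hsuf h.2), mul_zero]
      · rw [if_neg hm]
  rw [Finset.sum_congr rfl key, Finset.sum_ite_eq' ]
  split_ifs with h1 h2
  · rw [mul_one]; exact hf _
  · left; rw [mul_zero]
  · left; rfl

/-- **H2 WITH `h = 1` IN NISAN'S MODEL** (composition of Stubs C3, C4): a 0/1 polynomial over `ℝ≥0`
whose prefix-residual spans (realified) have real dimension `≤ r` at every cut of a fixed variable
order — e.g. one computed by a read-once oblivious ABP of width `r` in that order over any field of
characteristic `0` — has MONOTONE circuits of size `≤ (N+2)(2^r+1)³(d+2)²`: the transfer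
"0/1 + small rank ⇒ positive, with loss `2^{rank}`" of STRATEGY-CENSUS §1a(α), kernel-checked.
[cite: Nisan1991, Thm. 1] -/
theorem complexity_le_of_nisanRank (N d r : ℕ) (f : MvPolynomial (Fin N) NNReal)
    (hf : ∀ m, MvPolynomial.coeff m f = 0 ∨ MvPolynomial.coeff m f = 1)
    (hd : ∀ m ∈ f.support, ∀ j : Fin N, m j ≤ d)
    (hr : ∀ i : ℕ, i ≤ N →
      Module.finrank ℝ (Submodule.span ℝ ((MvPolynomial.map NNReal.toRealHom) ''
        {g : MvPolynomial (Fin N) NNReal | ∃ u : Fin N →₀ ℕ,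
          g = ∑ m ∈ f.support with Finsupp.filter (fun j : Fin N => (j : ℕ) < i) m = u,
                MvPolynomial.monomial (Finsupp.filter (fun j : Fin N => i ≤ (j : ℕ)) m)
                  (MvPolynomial.coeff m f)})) ≤ r) :
    Literature.Computability.AlgebraicComplexity.complexity f ≤
      (N + 2) * (2 ^ r + 1) ^ 3 * (d + 2) ^ 2 := by
  classical
  refine complexity_le_of_fewResiduals N d (2 ^ r) f hd fun i hi => ?_
  set R : Set (MvPolynomial (Fin N) NNReal) := {g : MvPolynomial (Fin N) NNReal | ∃ u : Fin N →₀ ℕ,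
          g = ∑ m ∈ f.support with Finsupp.filter (fun j : Fin N => (j : ℕ) < i) m = u,
                MvPolynomial.monomial (Finsupp.filter (fun j : Fin N => i ≤ (j : ℕ)) m)
                  (MvPolynomial.coeff m f)} with hR
  -- finiteness: every residual is the residual of a prefix of a support monomial, or `0`
  have hfin : R.Finite := by
    have hsub : R ⊆ insert 0 ((fun u => ∑ m ∈ f.support with
        Finsupp.filter (fun j : Fin N => (j : ℕ) < i) m = u,
          MvPolynomial.monomial (Finsupp.filter (fun j : Fin N => i ≤ (j : ℕ)) m)
            (MvPolynomial.coeff m f)) ''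
        ((fun m => Finsupp.filter (fun j : Fin N => (j : ℕ) < i) m) '' (f.support : Set (Fin N →₀ ℕ)))) := by
      rintro g ⟨u, rfl⟩
      by_cases hu : ∃ m ∈ f.support, Finsupp.filter (fun j : Fin N => (j : ℕ) < i) m = u
      · obtain ⟨m, hm, hmu⟩ := hu
        exact Set.mem_insert_of_mem _ ⟨u, ⟨m, hm, hmu⟩, rfl⟩
      · push Not at hu
        refine Set.mem_insert_iff.2 (Or.inl ?_)
        apply Finset.sum_eq_zero
        intro m hm
        rw [Finset.mem_filter] at hm
        exact absurd hm.2 (hu m hm.1)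
    exact ((Set.Finite.image _ ((Finset.finite_toSet _).image _)).insert 0).subset hsub
  -- the realification is injective and preserves 0/1 coefficients
  have hinj : Function.Injective
      (MvPolynomial.map NNReal.toRealHom : MvPolynomial (Fin N) NNReal → MvPolynomial (Fin N) ℝ) :=
    MvPolynomial.map_injective _ NNReal.coe_injective
  have hcard : R.ncard = ((MvPolynomial.map NNReal.toRealHom) '' R).ncard :=
    (Set.ncard_image_of_injective R hinj).symm
  rw [hcard]
  refine stub_zeroOne_ncard_le_two_pow_finrank (Fin N) _ (hfin.image _) ?_ |>.trans
    (Nat.pow_le_pow_right Nat.two_pos (hr i hi))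
  rintro g ⟨g₀, ⟨u, rfl⟩, rfl⟩ m
  rw [MvPolynomial.coeff_map]
  rcases coeff_residual_zero_or_one f hf i u m with h0 | h1
  · left; rw [h0]; rfl
  · right; rw [h1]; rfl


/-! ### Part D — NEW (lead c12): the shape of an uncharged certificate at the decisive instance `D_n`

Vocabulary of crux 4's negative toolkit (tree, `Theorems/TriangularDimersDivisionEasy/Negative/*`):
`triPM n` (= `D_n`, variables `(Fin n × Fin n) × (Fin n × Fin n)`), `dimers n`, `Adj`, `dimerExp`,
`Tfib = 6^44`, gadget placements `Gad = Bool × (ℤ × ℤ)`, `Valid`, `Far`, `uOf`/`vOf` (centre edge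
`18–25`), `vtx hn o c i` (placed ball vertex `i`; `19–25` is a diagonal edge of the unit rhombus `Q`).
The aligned block with corner `(p·m, q·m)` and side `m` is written inline. -/

section PartD

open Summit.ValiantsHypothesis.ValiantsHypothesis.Theorems.TriangularDimersDivisionEasy.Negative

/-- **Stub D1 — BLOCK RESTRICTION.**  Substituting, in `D_n`, the variable `x_(a,b)` by `1` when `a`
lies outside the aligned `m`-block `B = [p m, p m + m) × [q m, q m + m)`, by `0` when `a ∈ B`, `b ∉ B`,
and by the block-local variable `x_(a - (pm,qm), b - (pm,qm))` of `D_m` when `a, b ∈ B`, yields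
`c • D_m` with `c ≠ 0` — provided the complement of the block carries a dimer cover (`c` = the number
of such covers: a cover of `R_n` survives iff it maps `B` into `B`, and then splits as a cover of `B ≅ R_m`
and one of the complement). [folklore] -/
theorem stub_blockRestriction :
    ∀ (n m p q : ℕ) (hm : 0 < m), p * m + m ≤ n → q * m + m ≤ n →
      (∃ g : Fin n × Fin n → Fin n × Fin n, ∀ v : Fin n × Fin n,
        ¬ ((p * m ≤ (v.1 : ℕ) ∧ (v.1 : ℕ) < p * m + m) ∧ (q * m ≤ (v.2 : ℕ) ∧ (v.2 : ℕ) < q * m + m)) →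
          g (g v) = v ∧ g v ≠ v ∧ Adj v (g v) ∧
          ¬ ((p * m ≤ ((g v).1 : ℕ) ∧ ((g v).1 : ℕ) < p * m + m) ∧
             (q * m ≤ ((g v).2 : ℕ) ∧ ((g v).2 : ℕ) < q * m + m))) →
      ∃ c : ℝ≥0, c ≠ 0 ∧
        MvPolynomial.aeval (fun e : (Fin n × Fin n) × (Fin n × Fin n) =>
          if (p * m ≤ (e.1.1 : ℕ) ∧ (e.1.1 : ℕ) < p * m + m) ∧ (q * m ≤ (e.1.2 : ℕ) ∧ (e.1.2 : ℕ) < q * m + m) then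
            (if (p * m ≤ (e.2.1 : ℕ) ∧ (e.2.1 : ℕ) < p * m + m) ∧ (q * m ≤ (e.2.2 : ℕ) ∧ (e.2.2 : ℕ) < q * m + m) then
              (MvPolynomial.X ((⟨((e.1.1 : ℕ) - p * m) % m, Nat.mod_lt _ hm⟩, ⟨((e.1.2 : ℕ) - q * m) % m, Nat.mod_lt _ hm⟩),
                  (⟨((e.2.1 : ℕ) - p * m) % m, Nat.mod_lt _ hm⟩, ⟨((e.2.2 : ℕ) - q * m) % m, Nat.mod_lt _ hm⟩)) :
                MvPolynomial ((Fin m × Fin m) × (Fin m × Fin m)) ℝ≥0)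
            else 0)
          else 1) (triPM n) = c • triPM m :=
  Summit.ValiantsHypothesis.ValiantsHypothesis.Theorems.DivisionGapZeroOneTransfer.stub_blockRestriction

/-- **Stub D2 — THE COMPLEMENT OF AN ALIGNED EVEN BLOCK HAS A DIMER COVER** (horizontal dominoes
`(i, 2k) – (i, 2k+1)`: for even `m` the block's column range is a union of such pairs). [folklore] -/
theorem stub_blockComplementCover :
    ∀ (n m p q : ℕ), Even n → Even m → p * m + m ≤ n → q * m + m ≤ n →
      ∃ g : Fin n × Fin n → Fin n × Fin n, ∀ v : Fin n × Fin n,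
        ¬ ((p * m ≤ (v.1 : ℕ) ∧ (v.1 : ℕ) < p * m + m) ∧ (q * m ≤ (v.2 : ℕ) ∧ (v.2 : ℕ) < q * m + m)) →
          g (g v) = v ∧ g v ≠ v ∧ Adj v (g v) ∧
          ¬ ((p * m ≤ ((g v).1 : ℕ) ∧ ((g v).1 : ℕ) < p * m + m) ∧
             (q * m ≤ ((g v).2 : ℕ) ∧ ((g v).2 : ℕ) < q * m + m)) :=
  Summit.ValiantsHypothesis.ValiantsHypothesis.Theorems.DivisionGapZeroOneTransfer.stub_blockComplementCover

/-- **Stub D5 — TYPED GADGET SUPPLY.**  For a balanced `Z` (`n² < 3|Z| ≤ 2n²`, `n ≥ 64`) and any `W`,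
call the edge `{u, v}` FORBIDDEN when `¬((u ∈ Z ↔ v ∈ W) ∧ (v ∈ Z ↔ u ∈ W))` (no dimer cover `f` with
`∀ x, x ∈ Z ↔ f x ∈ W` can match `u` with `v`).  There are `≥ (n-60)/24` validly placed, pairwise far
gadgets each carrying a forbidden designated edge: its centre edge `18–25` (tag `true`) or its
diagonal `19–25` (tag `false`).  Cases: some union of the swap-classes `Z ∩ W`, `(Z ∪ W)ᶜ`, `Z △ W` is
balanced — Valiant's mixed gadgets for it (`exists_gadgets`; mixed ⇒ forbidden); otherwise
`3 |(Z △ W)ᶜ| ≤ n²` and every unit triangle `{c, c+(1,0), c+(0,1)}` not inside `Z ∩ W` or `(Z ∪ W)ᶜ`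
has a forbidden edge (direct placement at `c`: `18–25` or `19–25`; transposed: `18–25 = c–(c+(0,1))`),
`≥ (n-7)² - n²/3` candidates, a residue class of centres mod `8` is pairwise far. [folklore] -/
theorem stub_typedGadgets :
    ∀ (n : ℕ) (hn : 0 < n) (Z W : Finset (Fin n × Fin n)), 64 ≤ n →
      n * n < 3 * Z.card → 3 * Z.card ≤ 2 * (n * n) →
      ∃ G : List (Gad × Bool), n ≤ 24 * G.length + 60 ∧
        (∀ g ∈ G, Valid n g.1.1 g.1.2) ∧ (G.map Prod.fst).Pairwise Far ∧
        ∀ g ∈ G,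
          (g.2 = true → ¬ ((uOf hn g.1 ∈ Z ↔ vOf hn g.1 ∈ W) ∧ (vOf hn g.1 ∈ Z ↔ uOf hn g.1 ∈ W))) ∧
          (g.2 = false → ¬ ((vtx hn g.1.1 g.1.2 19 ∈ Z ↔ vtx hn g.1.1 g.1.2 25 ∈ W) ∧
                           (vtx hn g.1.1 g.1.2 25 ∈ Z ↔ vtx hn g.1.1 g.1.2 19 ∈ W))) :=
  Summit.ValiantsHypothesis.ValiantsHypothesis.Theorems.DivisionGapZeroOneTransfer.stub_typedGadgets

/-- **Stub D6 — PEELING FORBIDDEN EDGES.**  The dimer covers respecting the type `(Z, W)`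
(`∀ x, x ∈ Z ↔ f x ∈ W`) are at most a `((T-1)/T)^|G|` fraction of all covers, for every list `G` of
validly placed pairwise far gadgets each carrying a forbidden designated edge (centre `18–25`, tag
`true`, or diagonal `19–25`, tag `false`).  Same fibre argument as `peel`/`peel_step`, for the family
"avoids the designated edge of every gadget of `G`" (which contains the typed covers); the missing
cover in each fibre is one of the two local covers of `exists_two_covers` (re-derived with its full
content: `f₂` uses `18–25` and `12–19`, `f₁` uses `18–12` and `19–25`). [folklore] -/
theorem stub_forbiddenPeel :
    ∀ (n : ℕ) (hn : 0 < n) (Z W : Finset (Fin n × Fin n)) (G : List (Gad × Bool)),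
      (∀ g ∈ G, Valid n g.1.1 g.1.2) → (G.map Prod.fst).Pairwise Far →
      (∀ g ∈ G,
          (g.2 = true → ¬ ((uOf hn g.1 ∈ Z ↔ vOf hn g.1 ∈ W) ∧ (vOf hn g.1 ∈ Z ↔ uOf hn g.1 ∈ W))) ∧
          (g.2 = false → ¬ ((vtx hn g.1.1 g.1.2 19 ∈ Z ↔ vtx hn g.1.1 g.1.2 25 ∈ W) ∧
                           (vtx hn g.1.1 g.1.2 25 ∈ Z ↔ vtx hn g.1.1 g.1.2 19 ∈ W)))) →
      Tfib ^ G.length * ((dimers n).filter (fun f => ∀ x : Fin n × Fin n, (x ∈ Z ↔ f x ∈ W))).card ≤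
        (Tfib - 1) ^ G.length * (dimers n).card :=
  Summit.ValiantsHypothesis.ValiantsHypothesis.Theorems.DivisionGapZeroOneTransfer.stub_forbiddenPeel

/-- **Stub D7 — TYPED ROW-SUPPORT-BALANCED DECOMPOSITION, vertex-indexed variables** (port of the
landed `PerMultiplesHard.TypedDecomposition.stub_typedDecomposition` from `Fin n × Fin n` to
`(Fin n × Fin n) × (Fin n × Fin n)`): a polynomial over `ℝ≥0` all of whose monomials have first-vertex
sums `R` (all nonzero) and second-vertex sums `C` is a sum of `s ≤ L₊(g)` products `a_t · b_t` with
every `a_t` typed `(ρ, γ)` and `n² < 3 #{ρ ≠ 0} ≤ 2 n²`.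
[cite: JerrumSnir1982, §3.1 Lemma 3.1 and §3.3] -/
theorem stub_dimerTypedDecomposition :
    ∀ (n : ℕ), 2 ≤ n → ∀ (g : MvPolynomial ((Fin n × Fin n) × (Fin n × Fin n)) ℝ≥0)
      (R C : Fin n × Fin n → ℕ),
      (∀ m ∈ g.support, (∀ i, ∑ j, m (i, j) = R i) ∧ (∀ j, ∑ i, m (i, j) = C j)) → (∀ i, R i ≠ 0) →
      ∃ s : ℕ, s ≤ complexity g ∧
        ∃ a b : Fin s → MvPolynomial ((Fin n × Fin n) × (Fin n × Fin n)) ℝ≥0,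
          g = ∑ t, a t * b t ∧
          ∀ t, ∃ ρ γ : Fin n × Fin n → ℕ,
            (∀ m ∈ (a t).support, (∀ i, ∑ j, m (i, j) = ρ i) ∧ (∀ j, ∑ i, m (i, j) = γ j)) ∧
            n * n < 3 * (Finset.univ.filter fun i => ρ i ≠ 0).card ∧
            3 * (Finset.univ.filter fun i => ρ i ≠ 0).card ≤ 2 * (n * n) :=
  Summit.ValiantsHypothesis.ValiantsHypothesis.Theorems.DivisionGapZeroOneTransfer.stub_dimerTypedDecomposition

/-! ### Part D — the compositions (tree theorems p158446, p158570, re-exported) -/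

/-- **(D-I) OMNIPRESENCE** (tree: `mm_certificate_blockFloor`, p158446): for even `n`, even `m ≥ 64`,
`24 L + 60 ≤ m`, and any `X` with a monomial meeting fewer than `(n/m)²` first vertices,
`T^L ≤ 4 · L₊(D_n · X) · (m²+1)² · (T-1)^L`. [cite: Valiant1980, §3 Thm 1] -/
theorem mm_certificate_blockFloor_tree :
    ∀ (n m : ℕ), Even n → 64 ≤ m → Even m →
      ∀ (X : MvPolynomial ((Fin n × Fin n) × (Fin n × Fin n)) ℝ≥0),
        (∃ μ ∈ X.support, (μ.support.image fun e => e.1).card < (n / m) * (n / m)) →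
        ∀ (L : ℕ), 24 * L + 60 ≤ m →
          Tfib ^ L ≤ 4 * complexity (triPM n * X) * (m * m + 1) ^ 2 * (Tfib - 1) ^ L :=
  Summit.ValiantsHypothesis.ValiantsHypothesis.Theorems.DivisionGapZeroOneTransfer.mm_certificate_blockFloor

/-- **(D-I, asymptotic)** MM at `D_n` needs cofactors of degree `> n` (tree p158446). -/
theorem not_mm_certificate_of_degree_le_tree :
    ¬ ∃ c : ℕ, ∀ n : ℕ, ∃ X : MvPolynomial ((Fin n × Fin n) × (Fin n × Fin n)) ℝ≥0,
      X ≠ 0 ∧ X.totalDegree ≤ n ∧ complexity (triPM n * X) ≤ bound c n :=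
  Summit.ValiantsHypothesis.ValiantsHypothesis.Theorems.DivisionGapZeroOneTransfer.not_mm_certificate_of_degree_le

/-- **(D-I, asymptotic)** every monomial of a quasi-polynomial MM certificate for `D_n` has at least
`n² / 2^((log₂ n + c)^c)` variables (tree p158446). -/
theorem not_mm_certificate_with_sparse_monomial_tree :
    ¬ ∃ c : ℕ, ∀ n : ℕ, ∃ X : MvPolynomial ((Fin n × Fin n) × (Fin n × Fin n)) ℝ≥0,
      (∃ μ ∈ X.support, μ.support.card * bound c n < n * n) ∧
      complexity (triPM n * X) ≤ bound c n :=
  Summit.ValiantsHypothesis.ValiantsHypothesis.Theorems.DivisionGapZeroOneTransfer.not_mm_certificate_with_sparse_monomial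

/-- **(D-II) POWERS** (tree: `triPM_pow_lower_bound`, p158570): `T^L ≤ L₊(D_n^M) · (T-1)^L` for even
`n ≥ 64`, `M ≥ 1`, `24 L + 60 ≤ n`. [cite: Valiant1980, §3 Thm 1] -/
theorem triPM_pow_lower_bound_tree :
    ∀ (n M : ℕ), Even n → 64 ≤ n → 1 ≤ M → ∀ (L : ℕ), 24 * L + 60 ≤ n →
      Tfib ^ L ≤ complexity (triPM n ^ M) * (Tfib - 1) ^ L :=
  Summit.ValiantsHypothesis.ValiantsHypothesis.Theorems.DivisionGapZeroOneTransfer.triPM_pow_lower_bound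

/-- **(D-II, asymptotic)** no power of `D_n` is an MM certificate for `D_n` (tree p158570). -/
theorem not_mm_certificate_pow_tree :
    ¬ ∃ c : ℕ, ∀ n : ℕ, ∃ M : ℕ, complexity (triPM n * triPM n ^ M) ≤ bound c n :=
  Summit.ValiantsHypothesis.ValiantsHypothesis.Theorems.DivisionGapZeroOneTransfer.not_mm_certificate_pow

/-- **(D-II, asymptotic)** the double-dimer polynomial `D_n² = det(Kasteleyn)` is not
monotone-quasi-polynomial (tree p158570). -/
theorem not_qp_complexity_triPM_sq_tree :
    ¬ ∃ c : ℕ, ∀ n : ℕ, complexity (triPM n * triPM n) ≤ bound c n :=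
  Summit.ValiantsHypothesis.ValiantsHypothesis.Theorems.DivisionGapZeroOneTransfer.not_qp_complexity_triPM_sq

/-- **(D-I′) EDGE FLOOR** (tree p159118): every monomial of a quasi-polynomial MM certificate for `D_n` has at
least `n² / 2^((log₂ n + c)^c)` distinct EDGE variables. -/
theorem not_mm_certificate_with_few_edge_variables_tree :
    ¬ ∃ c : ℕ, ∀ n : ℕ, ∃ X : MvPolynomial ((Fin n × Fin n) × (Fin n × Fin n)) ℝ≥0,
      (∃ μ ∈ X.support, (μ.support.filter fun e => Adj e.1 e.2).card * bound c n < n * n) ∧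
      complexity (triPM n * X) ≤ bound c n :=
  Summit.ValiantsHypothesis.ValiantsHypothesis.Theorems.DivisionGapZeroOneTransfer.not_mm_certificate_with_few_edge_variables

/-- **(D-III) PRODUCTS** (tree p159397): `X = D_n^M · Y` with one monomial of `Y` meeting fewer than `(n/m)²`
first vertices ⇒ `T^L ≤ (L₊(D_n^M · Y) + 1) · (T-1)^L`. [cite: Valiant1980, §3 Thm 1] -/
theorem triPM_pow_mul_blockFloor_tree :
    ∀ (n m M : ℕ), Even n → 64 ≤ m → Even m → 1 ≤ M →
      ∀ (Y : MvPolynomial ((Fin n × Fin n) × (Fin n × Fin n)) ℝ≥0),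
        (∃ μ ∈ Y.support, (μ.support.image fun e => e.1).card < (n / m) * (n / m)) →
        ∀ (L : ℕ), 24 * L + 60 ≤ m →
          Tfib ^ L ≤ (complexity (triPM n ^ M * Y) + 1) * (Tfib - 1) ^ L :=
  Summit.ValiantsHypothesis.ValiantsHypothesis.Theorems.DivisionGapZeroOneTransfer.triPM_pow_mul_blockFloor

/-- **(D-III, asymptotic)** (tree p159397): no `D_n^M · Y` with `Y` having a monomial of fewer than
`n² / 2^((log₂ n + c)^c)` variables is an MM certificate for `D_n` (unifies D-I and D-II). -/
theorem not_mm_certificate_pow_mul_sparse_tree :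
    ¬ ∃ c : ℕ, ∀ n : ℕ, ∃ (M : ℕ) (Y : MvPolynomial ((Fin n × Fin n) × (Fin n × Fin n)) ℝ≥0),
      (∃ μ ∈ Y.support, μ.support.card * bound c n < n * n) ∧
      complexity (triPM n ^ (M + 1) * Y) ≤ bound c n :=
  Summit.ValiantsHypothesis.ValiantsHypothesis.Theorems.DivisionGapZeroOneTransfer.not_mm_certificate_pow_mul_sparse

/-- **(D-IV) NO MONOMIAL INITIAL FORM** (tree p160331): no MM certificate for `D_n` has a single monomial as
`w`-initial form for a weight `w` along which `D_n` is homogeneous. [cite: JuknaSeiwertSergeev2022, Lemma 2] -/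
theorem not_mm_certificate_monomialTop_tree :
    ¬ ∃ c : ℕ, ∀ n : ℕ, ∃ (X : MvPolynomial ((Fin n × Fin n) × (Fin n × Fin n)) ℝ≥0)
      (w : (Fin n × Fin n) × (Fin n × Fin n) → ℕ) (d : ℕ) (u : (Fin n × Fin n) × (Fin n × Fin n) →₀ ℕ) (a : ℝ≥0),
      MvPolynomial.IsWeightedHomogeneous w (triPM n) d ∧ a ≠ 0 ∧
      Summit.ValiantsHypothesis.ValiantsHypothesis.Theorems.ZeroOneTransfer.Negative.topComponent w X =
        MvPolynomial.monomial u a ∧ complexity (triPM n * X) ≤ bound c n :=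
  Summit.ValiantsHypothesis.ValiantsHypothesis.Theorems.DivisionGapZeroOneTransfer.not_mm_certificate_monomialTop

/-- **(D-IV) NO MONOMIAL FINAL FORM** (tree p160331): bottom-component twin. -/
theorem not_mm_certificate_monomialBot_tree :
    ¬ ∃ c : ℕ, ∀ n : ℕ, ∃ (X : MvPolynomial ((Fin n × Fin n) × (Fin n × Fin n)) ℝ≥0)
      (w : (Fin n × Fin n) × (Fin n × Fin n) → ℕ) (d : ℕ) (u : (Fin n × Fin n) × (Fin n × Fin n) →₀ ℕ) (a : ℝ≥0),
      MvPolynomial.IsWeightedHomogeneous w (triPM n) d ∧ a ≠ 0 ∧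
      Summit.ValiantsHypothesis.ValiantsHypothesis.Theorems.DivisionGapZeroOneTransfer.ProjClosure.botComponent w X =
        MvPolynomial.monomial u a ∧ complexity (triPM n * X) ≤ bound c n :=
  Summit.ValiantsHypothesis.ValiantsHypothesis.Theorems.DivisionGapZeroOneTransfer.not_mm_certificate_monomialBot

end PartD

/-! ## Part E — NEW (lead c13): ISOLATING FACES

Free top/bottom forms that isolate ONE monomial of a cofactor `X` while `D_n` degenerates to an
edge-restricted dimer polynomial `D_n[E₀] = triPMIn E₀` which still contains a full triangular block; the
shared engine (Stub E1) then strips the monomial by JSS contraction, restricts to the block (generalised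
block restriction, arbitrary corner, covers inside `E₀`) and applies Valiant's bound.  Vocabulary:
`Theorems/DivisionGapZeroOneTransferFaceIsolationDefs.lean` (p164143).  Rung E-I answers c12's
disprover-wanted (`X = Sq_n`) with NO square-grid gadgets (a brick-wall zone is frozen); rung E-II closes the
few-monomials hole of Part D (the binomial of two domino tilings survives D-I–D-IV).  STATUS (lead c13): all
twelve stubs and the E-I assembly (`Theorems/DivisionGapZeroOneTransferSqPartner.lean`, p169154:
`sq_partner_lower_bound`, `not_qp_complexity_triPM_mul_sqPM`) are tree theorems, re-exported below; the E-II
assembly `fewMonomials_lower_bound` is proved here from them and lands as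
`Theorems/DivisionGapZeroOneTransferFewMonomials.lean`. -/

section PartE

open Summit.ValiantsHypothesis.ValiantsHypothesis.Theorems.TriangularDimersDivisionEasy.Negative
open Summit.ValiantsHypothesis.ValiantsHypothesis.Theorems.ZeroOneTransfer
open Summit.ValiantsHypothesis.ValiantsHypothesis.Theorems.DivisionGapZeroOneTransfer
open Summit.ValiantsHypothesis.ValiantsHypothesis.Theorems.DivisionGapZeroOneTransfer.FaceIsolation

/-! ### Part E — registered stubs -/

/-- **Stub E1 — THE FACE ENGINE.**  For an edge predicate `E₀` containing every triangular edge inside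
the block `[r₀, r₀+m) × [c₀, c₀+m)` (`m ≥ 64` even) and admitting a cover of the block's complement
inside `E₀`, and any monomial `a·x^u` (`a ≠ 0`):
`T^L ≤ 4 · ((n²+2)(L₊(D_n[E₀] · a x^u) + 3))^κ · (m²+1)² · (T-1)^L` for `24L + 60 ≤ m` — JSS contraction
strips the monomial, the block substitution (a positive projection) maps `D_n[E₀]` to `c • D_m`, `c ≠ 0`,
and Valiant's bound applies. [cite: Valiant1980, §3 Thm 1] [cite: JuknaSeiwertSergeev2022, Lemma 2] -/
theorem stub_faceEngine :
    ∃ κ : ℕ, ∀ (n : ℕ) (E₀ : Vtx n → Vtx n → Prop) [DecidableRel E₀] (u : Var n →₀ ℕ) (a : ℝ≥0),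
      a ≠ 0 → ∀ (r₀ c₀ m : ℕ), 64 ≤ m → Even m → r₀ + m ≤ n → c₀ + m ≤ n →
      (∀ v w : Vtx n, InBlock r₀ c₀ m v → InBlock r₀ c₀ m w → Adj v w → E₀ v w) →
      (∃ g : Vtx n → Vtx n, ∀ v, ¬ InBlock r₀ c₀ m v →
          g (g v) = v ∧ g v ≠ v ∧ Adj v (g v) ∧ ¬ InBlock r₀ c₀ m (g v) ∧ E₀ v (g v)) →
      ∀ L : ℕ, 24 * L + 60 ≤ m →
        Tfib ^ L ≤ 4 * ((n * n + 2) * (complexity (triPMIn E₀ * monomial u a) + 3)) ^ κ *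
          (m * m + 1) ^ 2 * (Tfib - 1) ^ L :=
  Summit.ValiantsHypothesis.ValiantsHypothesis.Theorems.DivisionGapZeroOneTransfer.stub_faceEngine

/-- **Stub E2a — top form of `D_n` in an indicator direction**: if some cover lies inside `E₀`, the top
component of `D_n` for the indicator weight of `E₀` is `D_n[E₀]`. [folklore] -/
theorem stub_topComponent_wInd_triPM : ∀ (n : ℕ) (E₀ : Vtx n → Vtx n → Prop) [DecidableRel E₀],
    (∃ f ∈ dimers n, ∀ v, E₀ v (f v)) → Negative.topComponent (wInd E₀) (triPM n) = triPMIn E₀ :=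
  Summit.ValiantsHypothesis.ValiantsHypothesis.Theorems.DivisionGapZeroOneTransfer.stub_topComponent_wInd_triPM

/-- **Stub E2b — top form of `Sq_n` in an indicator direction.** [folklore] -/
theorem stub_topComponent_wInd_sqPM : ∀ (n : ℕ) (E₀ : Vtx n → Vtx n → Prop) [DecidableRel E₀],
    (∃ f ∈ sqDimers n, ∀ v, E₀ v (f v)) → Negative.topComponent (wInd E₀) (sqPM n) = sqPMIn E₀ :=
  Summit.ValiantsHypothesis.ValiantsHypothesis.Theorems.DivisionGapZeroOneTransfer.stub_topComponent_wInd_sqPM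

/-- **Stub E2c — a uniquely tiled predicate gives a monomial.** [folklore] -/
theorem stub_sqPMIn_eq_monomial : ∀ (n : ℕ) (E₀ : Vtx n → Vtx n → Prop) [DecidableRel E₀]
    (u₀ : Vtx n → Vtx n), u₀ ∈ sqDimers n → (∀ v, E₀ v (u₀ v)) →
    (∀ f ∈ sqDimers n, (∀ v, E₀ v (f v)) → f = u₀) → sqPMIn E₀ = monomial (dimerExp u₀) 1 :=
  Summit.ValiantsHypothesis.ValiantsHypothesis.Theorems.DivisionGapZeroOneTransfer.stub_sqPMIn_eq_monomial

/-- **Stub E2d — bottom form of `D_n` under a penalty on non-horizontal pairs**: the covers of penalty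
`0` are exactly the covers avoiding `F`, and the horizontal-domino cover is one of them. [folklore] -/
theorem stub_botComponent_avoid_triPM : ∀ (n : ℕ) (F : Finset (Var n)) (p : Var n → ℕ), Even n →
    (∀ e ∈ F, ¬ IsHoriz e) → (∀ e ∈ F, 0 < p e) → (∀ e, e ∉ F → p e = 0) →
    ProjClosure.botComponent p (triPM n) = triPMIn (Avoid F) :=
  Summit.ValiantsHypothesis.ValiantsHypothesis.Theorems.DivisionGapZeroOneTransfer.stub_botComponent_avoid_triPM

/-- **Stub E2e — a strict minimiser is the whole bottom form.** [folklore] -/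
theorem stub_botComponent_eq_monomial : ∀ (n : ℕ) (p : Var n → ℕ) (X : MvPolynomial (Var n) ℝ≥0)
    (û : Var n →₀ ℕ), û ∈ X.support →
    (∀ u ∈ X.support, u ≠ û → Finsupp.weight p û < Finsupp.weight p u) →
    ProjClosure.botComponent p X = monomial û (coeff û X) :=
  Summit.ValiantsHypothesis.ValiantsHypothesis.Theorems.DivisionGapZeroOneTransfer.stub_botComponent_eq_monomial

/-- **Stub E3 — A BRICK ZONE IS FROZEN.**  Inside the square-lattice part `G0sq` of the rung's edge
predicate (square edges with both ends in the same zone, or dominoes of `u₀`), the only domino tiling is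
`u₀`: cells off the zones have a single `G0sq`-edge, and inside a zone the bricks are forced column by
column (the cell below/above the left cell of a brick is the RIGHT cell of its own brick). [folklore] -/
theorem stub_brickZone_unique : ∀ (n m b : ℕ), Even m → Even b → m + 2 ≤ b → b + 2 * m + 2 ≤ n →
    (∀ v : Vtx n, InZone m b v → ((u0 m b v).1 : ℕ) = (brick m ((v.1 : ℕ), (v.2 : ℕ))).1 ∧
        ((u0 m b v).2 : ℕ) = (brick m ((v.1 : ℕ), (v.2 : ℕ))).2) →
    ∀ f : Vtx n → Vtx n, IsSqDimer f → (∀ v, G0sq m b v (f v)) → f = u0 m b :=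
  Summit.ValiantsHypothesis.ValiantsHypothesis.Theorems.DivisionGapZeroOneTransfer.stub_brickZone_unique

/-- **Stub E4 — THE EXPLICIT TILING `u₀` IS A DOMINO TILING** of the whole square extending the bricks
(and its ℕ-recipe never leaves the square). [folklore] -/
theorem stub_u0_isSqDimer : ∀ (n m b : ℕ), Even n → Even m → Even b → 2 ≤ m → m + 2 ≤ b →
    b + 2 * m + 2 ≤ n →
    IsSqDimer (u0 (n := n) m b) ∧
    ∀ v : Vtx n, ((u0 m b v).1 : ℕ) = (u0Nat m b ((v.1 : ℕ), (v.2 : ℕ))).1 ∧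
      ((u0 m b v).2 : ℕ) = (u0Nat m b ((v.1 : ℕ), (v.2 : ℕ))).2 :=
  Summit.ValiantsHypothesis.ValiantsHypothesis.Theorems.DivisionGapZeroOneTransfer.stub_u0_isSqDimer

/-- **Stub E5 — THE RING COVER.**  The block `B' = [2, m-2) × [b+2, b+m-2)` sits inside the first zone
with a margin; every triangular edge inside `B'` is in `E0sq`, and the complement of `B'` has a cover
inside `E0sq`: `u₀` off the first zone, and on the ring (first zone minus `B'`) the bricks of rows
`0, 1, m-2, m-1` plus an explicit matching of the 4-row chunks of the side strips. [folklore] -/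
theorem stub_ringCover : ∀ (n m b : ℕ), Even n → m % 4 = 0 → Even b → 8 ≤ m → m + 2 ≤ b →
    b + 2 * m + 2 ≤ n → IsSqDimer (u0 (n := n) m b) →
    (∀ v : Vtx n, ((u0 m b v).1 : ℕ) = (u0Nat m b ((v.1 : ℕ), (v.2 : ℕ))).1 ∧
      ((u0 m b v).2 : ℕ) = (u0Nat m b ((v.1 : ℕ), (v.2 : ℕ))).2) →
    (∀ v w : Vtx n, InBlock 2 (b + 2) (m - 4) v → InBlock 2 (b + 2) (m - 4) w → Adj v w →
      E0sq m b v w) ∧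
    ∃ g : Vtx n → Vtx n, ∀ v, ¬ InBlock 2 (b + 2) (m - 4) v →
      g (g v) = v ∧ g v ≠ v ∧ Adj v (g v) ∧ ¬ InBlock 2 (b + 2) (m - 4) (g v) ∧ E0sq m b v (g v) :=
  Summit.ValiantsHypothesis.ValiantsHypothesis.Theorems.DivisionGapZeroOneTransfer.stub_ringCover

/-- **Stub E6 — OFF-HORIZONTAL RIGIDITY.**  Two exponents with the same row margins and the same column
margins which agree on every non-horizontal variable are equal: in each row the differences of the
rightward/leftward horizontal exponents form a circulation on a path, which vanishes from its ends.
[folklore] -/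
theorem stub_offHoriz_rigid : ∀ (n : ℕ) (u u' : Var n →₀ ℕ),
    (∀ v : Vtx n, ∑ w, u (v, w) = ∑ w, u' (v, w)) → (∀ w : Vtx n, ∑ v, u (v, w) = ∑ v, u' (v, w)) →
    (∀ e : Var n, ¬ IsHoriz e → u e = u' e) → u = u' :=
  Summit.ValiantsHypothesis.ValiantsHypothesis.Theorems.DivisionGapZeroOneTransfer.stub_offHoriz_rigid

/-- **Stub E7 — LEXICOGRAPHIC PENALTY ISOLATION.**  In a finite set of exponents any two of which differ
on a non-horizontal variable, one exponent is the strict minimiser of a weight supported on fewer than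
`#S` non-horizontal variables (split off the minimisers of one separating variable and recurse).
[folklore] -/
theorem stub_isolate_offHoriz : ∀ (n : ℕ) (S : Finset (Var n →₀ ℕ)), S.Nonempty →
    (∀ u ∈ S, ∀ u' ∈ S, (∀ e : Var n, ¬ IsHoriz e → u e = u' e) → u = u') →
    ∃ (F : Finset (Var n)) (p : Var n → ℕ) (û : Var n →₀ ℕ), û ∈ S ∧ F.card + 1 ≤ S.card ∧
      (∀ e ∈ F, ¬ IsHoriz e) ∧ (∀ e ∈ F, 0 < p e) ∧ (∀ e, e ∉ F → p e = 0) ∧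
      (∀ u ∈ S, u ≠ û → Finsupp.weight p û < Finsupp.weight p u) :=
  Summit.ValiantsHypothesis.ValiantsHypothesis.Theorems.DivisionGapZeroOneTransfer.stub_isolate_offHoriz

/-- **Stub E8 — TORUS WLOG FOR `D_n`** (free iterated top forms along the `2n²` first- and second-vertex
indicator weights, for each of which `D_n` is homogeneous of degree `1`): a nonzero cofactor may be
replaced, at no cost and inside its own support, by a MARGIN-HOMOGENEOUS one. [folklore] -/
theorem stub_torusD : ∀ (n : ℕ) (X : MvPolynomial (Var n) ℝ≥0), X ≠ 0 →
    ∃ X₁ : MvPolynomial (Var n) ℝ≥0, X₁ ≠ 0 ∧ X₁.support ⊆ X.support ∧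
      (∀ d₁ ∈ X₁.support, ∀ d₂ ∈ X₁.support,
        (∀ v : Vtx n, ∑ w, d₁ (v, w) = ∑ w, d₂ (v, w)) ∧ (∀ w : Vtx n, ∑ v, d₁ (v, w) = ∑ v, d₂ (v, w))) ∧
      complexity (triPM n * X₁) ≤ complexity (triPM n * X) :=
  Summit.ValiantsHypothesis.ValiantsHypothesis.Theorems.DivisionGapZeroOneTransfer.stub_torusD

/-! ### Part E — compositions (sorry-free modulo the stubs) -/


/-- **Rung E-I: THE SQUARE-GRID PARTNER IS NOT A CERTIFICATE.**  For even `n`, `m ≡ 0 (mod 4)`,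
`68 ≤ m`, `3m + 4 ≤ n` and `24L + 60 ≤ m - 4`:
`T^L ≤ 4 · ((n²+2)(L₊(D_n · Sq_n) + 3))^κ · ((m-4)²+1)² · (T-1)^L` — with `m ≈ n/3` an exponential lower
bound `L₊(D_n · Sq_n) ≥ 2^{Ω(n)/κ} / poly(n)`.  Free top form along the indicator weight of `E0sq`
(the brick zones are frozen: Stubs E3/E4, so the `Sq_n` side collapses to `x^{u₀}` while the `D_n` side
keeps every triangular edge inside the zones: Stubs E2a–c), then the engine (Stub E1) on the block
`[2, m-2) × [m+4, 2m)` of the first zone (Stub E5). [cite: Valiant1980, §3 Thm 1]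
[cite: JuknaSeiwertSergeev2022, Lemma 2] -/
theorem sq_partner_lower_bound : ∃ κ : ℕ, ∀ (n m : ℕ), Even n → m % 4 = 0 → 68 ≤ m → 3 * m + 4 ≤ n →
    ∀ L : ℕ, 24 * L + 60 ≤ m - 4 →
      Tfib ^ L ≤ 4 * ((n * n + 2) * (complexity (triPM n * sqPM n) + 3)) ^ κ *
        ((m - 4) * (m - 4) + 1) ^ 2 * (Tfib - 1) ^ L :=
  Summit.ValiantsHypothesis.ValiantsHypothesis.Theorems.DivisionGapZeroOneTransfer.sq_partner_lower_bound

/-- **Rung E-II: CERTIFICATES HAVE MANY MONOMIALS.**  For even `n`, even `m ≥ 64`, `24L + 60 ≤ m`, and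
any nonzero `X` with `2 · #supp X ≤ (n/m)²`:
`T^L ≤ 4 · ((n²+2)(L₊(D_n · X) + 3))^κ · (m²+1)² · (T-1)^L`.  Torus WLOG (Stub E8), off-horizontal
rigidity (E6), lexicographic penalty isolation on `< #supp X` non-horizontal pairs (E7), free bottom
form (E2d/e), the engine (E1) on an aligned block avoiding the penalised pairs (pigeonhole
`exists_block_avoiding`; complement covered by horizontal dominoes, which avoid non-horizontal pairs).
[cite: Valiant1980, §3 Thm 1] [cite: JuknaSeiwertSergeev2022, Lemma 2] -/
theorem fewMonomials_lower_bound : ∃ κ : ℕ, ∀ (n m : ℕ), Even n → 64 ≤ m → Even m →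
    ∀ X : MvPolynomial (Var n) ℝ≥0, X ≠ 0 → 2 * X.support.card ≤ (n / m) * (n / m) →
    ∀ L : ℕ, 24 * L + 60 ≤ m →
      Tfib ^ L ≤ 4 * ((n * n + 2) * (complexity (triPM n * X) + 3)) ^ κ * (m * m + 1) ^ 2 *
        (Tfib - 1) ^ L :=
  Summit.ValiantsHypothesis.ValiantsHypothesis.Theorems.DivisionGapZeroOneTransfer.fewMonomials_lower_bound

/-! ### Part E-IV — the H1 TRANSFER of rung E-II (lead c13): cofactors of the PERMANENT with few monomials

Registered stubs P1–P6, ALL LANDED (`Theorems/DivisionGapZeroOneTransferPerIsolation.lean` p169693: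
`stub_isolate_pred`, `stub_offDiag_rigid`, `stub_torusPer`; `Theorems/DivisionGapZeroOneTransferPerForms.lean`
p169804: `stub_botComponent_avoid_perPoly`, `stub_botComponent_eq_monomial_gen`, `stub_support_perKill_perAvoid`),
and the assembly `Theorems/DivisionGapZeroOneTransferPerFewMonomials.lean` (`per_fewMonomials_lower_bound`,
`perMultiplesHard_fewMonomials`, `perDivisionHard_fewMonomials`): cruxes 2/9 of the route hold for all cofactors
with `≤ n/4` monomials, of any degree.  Re-exported: -/

/-- **P1 (tree p169693)** generic lexicographic penalty isolation. [folklore] -/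
theorem stub_isolate_pred : ∀ (σ : Type) [DecidableEq σ] (Q : σ → Prop) [DecidablePred Q]
    (S : Finset (σ →₀ ℕ)), S.Nonempty →
    (∀ u ∈ S, ∀ u' ∈ S, (∀ e : σ, Q e → u e = u' e) → u = u') →
    ∃ (F : Finset σ) (p : σ → ℕ) (û : σ →₀ ℕ), û ∈ S ∧ F.card + 1 ≤ S.card ∧
      (∀ e ∈ F, Q e) ∧ (∀ e ∈ F, 0 < p e) ∧ (∀ e, e ∉ F → p e = 0) ∧
      (∀ u ∈ S, u ≠ û → Finsupp.weight p û < Finsupp.weight p u) :=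
  Summit.ValiantsHypothesis.ValiantsHypothesis.Theorems.DivisionGapZeroOneTransfer.stub_isolate_pred

/-- **P2 (tree p169693)** off-diagonal rigidity for the permanent's variables. [folklore] -/
theorem stub_offDiag_rigid : ∀ (n : ℕ) (u u' : Fin n × Fin n →₀ ℕ),
    (∀ j : Fin n, ∑ i, u (i, j) = ∑ i, u' (i, j)) →
    (∀ e : Fin n × Fin n, e.1 ≠ e.2 → u e = u' e) → u = u' :=
  Summit.ValiantsHypothesis.ValiantsHypothesis.Theorems.DivisionGapZeroOneTransfer.stub_offDiag_rigid

/-- **P3 (tree p169693)** torus WLOG for `per_n` inside the support. [folklore] -/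
theorem stub_torusPer : ∀ (n : ℕ) (h : MvPolynomial (Fin n × Fin n) ℝ≥0), h ≠ 0 →
    ∃ h₁ : MvPolynomial (Fin n × Fin n) ℝ≥0, h₁ ≠ 0 ∧ h₁.support ⊆ h.support ∧
      (∀ d₁ ∈ h₁.support, ∀ d₂ ∈ h₁.support,
        (∀ i : Fin n, ∑ j, d₁ (i, j) = ∑ j, d₂ (i, j)) ∧ (∀ j : Fin n, ∑ i, d₁ (i, j) = ∑ i, d₂ (i, j))) ∧
      complexity (Literature.Computability.AlgebraicComplexity.perPoly (Fin n) ℝ≥0 * h₁) ≤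
        complexity (Literature.Computability.AlgebraicComplexity.perPoly (Fin n) ℝ≥0 * h) :=
  Summit.ValiantsHypothesis.ValiantsHypothesis.Theorems.DivisionGapZeroOneTransfer.stub_torusPer


/-! ### Part E-III — the engine for POWERS and mixed products `D_n^{M+1} · Sq_n^{M'}` (lead c13)

`stub_faceEnginePow` LANDED (`Theorems/DivisionGapZeroOneTransferFaceEnginePow.lean`, p170241); assembly
`Theorems/DivisionGapZeroOneTransferSqPowPartner.lean` (p170290: `sq_pow_partner_lower_bound`,
`not_qp_complexity_triPM_pow_mul_sqPM_pow` — no mixed product is qp, uniformly in `M, M'`).  Re-exported: -/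

/-- **E1' (tree p170241)** the face engine for powers. [cite: Valiant1980, §3 Thm 1] -/
theorem stub_faceEnginePow :
    ∃ κ : ℕ, ∀ (n : ℕ) (E₀ : Vtx n → Vtx n → Prop) [DecidableRel E₀] (u : Var n →₀ ℕ) (a : ℝ≥0),
      a ≠ 0 → ∀ (r₀ c₀ m M : ℕ), 64 ≤ m → Even m → r₀ + m ≤ n → c₀ + m ≤ n →
      (∀ v w : Vtx n, InBlock r₀ c₀ m v → InBlock r₀ c₀ m w → Adj v w → E₀ v w) →
      (∃ g : Vtx n → Vtx n, ∀ v, ¬ InBlock r₀ c₀ m v →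
          g (g v) = v ∧ g v ≠ v ∧ Adj v (g v) ∧ ¬ InBlock r₀ c₀ m (g v) ∧ E₀ v (g v)) →
      ∀ L : ℕ, 24 * L + 60 ≤ m →
        Tfib ^ L ≤ (((n * n + 2) * (complexity (triPMIn E₀ ^ (M + 1) * monomial u a) + 3)) ^ κ + 1) *
          (Tfib - 1) ^ L :=
  Summit.ValiantsHypothesis.ValiantsHypothesis.Theorems.DivisionGapZeroOneTransfer.stub_faceEnginePow

/-- **(E-III, tree p170290)** no mixed product `D_n^{M+1} · Sq_n^{M'}` is quasi-polynomial, uniformly in `M, M'`.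
[cite: Valiant1980, §3 Thm 1] -/
theorem not_qp_complexity_triPM_pow_mul_sqPM_pow_tree :
    ¬ ∃ c : ℕ, ∀ n : ℕ, ∃ M M' : ℕ, complexity (triPM n ^ (M + 1) * sqPM n ^ M') ≤ bound c n :=
  Summit.ValiantsHypothesis.ValiantsHypothesis.Theorems.DivisionGapZeroOneTransfer.not_qp_complexity_triPM_pow_mul_sqPM_pow

/-- **(E-IV, tree p169948)** `PerMultiplesHard` for cofactors with `≤ n/4` monomials. [cite: JerrumSnir1982, §4.3 and Cor. 3.5] -/
theorem perMultiplesHard_fewMonomials_tree : ∀ c : ℕ, ∃ n₀ : ℕ, ∀ n ≥ n₀,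
    ∀ h : MvPolynomial (Fin n × Fin n) ℝ≥0, h ≠ 0 → 4 * h.support.card ≤ n →
      2 ^ ((Nat.log 2 n + c) ^ c) < complexity (Literature.Computability.AlgebraicComplexity.perPoly (Fin n) ℝ≥0 * h) :=
  Summit.ValiantsHypothesis.ValiantsHypothesis.Theorems.DivisionGapZeroOneTransfer.perMultiplesHard_fewMonomials

/-- **(E-I, tree p169154)** `L₊(D_n · Sq_n)` is not quasi-polynomial. [cite: Valiant1980, §3 Thm 1] -/
theorem not_qp_complexity_triPM_mul_sqPM_tree :
    ¬ ∃ c : ℕ, ∀ n : ℕ, complexity (triPM n * sqPM n) ≤ bound c n :=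
  Summit.ValiantsHypothesis.ValiantsHypothesis.Theorems.DivisionGapZeroOneTransfer.not_qp_complexity_triPM_mul_sqPM

/-- **(E-II, tree p169515)** MM certificates for `D_n` have `≥ n²/qp` monomials. [cite: Valiant1980, §3 Thm 1] -/
theorem not_mm_certificate_with_few_monomials_tree :
    ¬ ∃ c : ℕ, ∀ n : ℕ, ∃ X : MvPolynomial (Var n) ℝ≥0,
      X ≠ 0 ∧ X.support.card * bound c n < n * n ∧ complexity (triPM n * X) ≤ bound c n :=
  Summit.ValiantsHypothesis.ValiantsHypothesis.Theorems.DivisionGapZeroOneTransfer.not_mm_certificate_with_few_monomials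

end PartE

end Summit.ValiantsHypothesis.ValiantsHypothesis.Cruxes.ZeroOneTransfer.ChargedUncharged
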